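import Summits.RiemannHypothesis.RiemannHypothesis.Theorems.HandoffDodgerCeiling
import Summits.RiemannHypothesis.RiemannHypothesis.Theorems.SemilocalWindowMarkov
import Summits.RiemannHypothesis.RiemannHypothesis.Theorems.HandoffDodgerUpperClause
import Mathlib.Analysis.Complex.ExponentialBounds
import HarnessLib

/-!
# WEIL column — scale-generic RH-FREE wall ceilings for the semilocal thresholds, the two DATA-fork targets (one-constant · tower), and their reductions (rh-explicit, D-0040 WEIL column theory seat cc-s2-3; D-0059 route item support)

RH-FREE (every `def … : Prop` below is an UPPER bound `δ*(q) ≤ s(q)` on the wall offset `δ*(q) = a*(S_q) − (log q)/2` of the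
finite-place Weil forms — no instance and no `∀ q` form of it implies or approaches RH; RH is `∀ q, 0 ≤ δ*(q)`,
`HandoffMarginLaw.riemannHypothesis_iff_forall_wallOffset_nonneg`). Nothing here bears on the truth of RH.

WHAT IS TYPED AND PROVED. The WEIL data column's fork (HOME/EXTREMALS/semilocal/predictions/PREREG-ccs23-g20-K53-fork,
PREREG-ccs23-g20-v5fork; memos HOME/cc-s2-3/gen20/theory/WEIL-THEORY-R1/R2) is between two SHAPES for `δ*(q) = wallOffset q`:
* (C) the one-constant law `δ*(q) = c/(w_q q²) = c/(2 q^{3/2} log q)` (`w_q = 2 log q/√q`; kinked-cell constants 0.0897 → 0.0885 over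
  q = 37 … 47) — asymptotic exponent 3/2, log power −1;
* (T)/(T′) the prolate TOWER `δ*(q) = (a log q + 2.43)²(1 + 2.07/q)/(32π² q²)` — asymptotic exponent 2, log power +2.
Their UPPER halves are RH-free `∀ q` targets. The tree types the exponent-3/2 envelope `Handoff.DodgerWallCeiling C q₀`
(`δ*(q) ≤ C (log q)^{3/2} q^{−3/2}`) and its reduction to a `SubwindowWitnessFamily`. This file (i) makes the scale a parameter
(`WallCeilingAtScale s q₀`; witness families `SubwindowWitnessFamilyAtScale` (smooth Weil tests, small-translate criterion) and
`MarkovWitnessFamilyAtScale` (bounded odd a.e.-continuous witnesses with jumps — the class of the certified K-cell vectors — through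
cc-s2-4's window bridge `weilSemilocalThreshold_le_of_markovWitness_window`), with both reductions proved), (ii) names the two fork
scales `oneConstantScale c` / `towerScale A B` and targets `OneConstantWallCeiling c q₀` / `TowerWallCeiling A B q₀`, (iii) PROVES
the order TOWER(A,B) ⟹ DODGER(C) (every C > 0, explicit threshold) and ONE-CONSTANT(c) ⟹ DODGER(C) (c ≤ 2C), so either target, once
proved, discharges `DodgerWallCeiling` and hence — by `SemilocalClassLaw.semilocalClassLawFrom_of_wallCeiling` — the TAIL of the
class law C-I(a) from an explicit prime. No number is fitted INTO a statement: `c`, `A`, `B`, `q₀` are parameters; the data only say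
which target deserves a prover (on the (C) branch `TowerWallCeiling A B q₀` is false for all `A, B`; on the tower branch it is the
sharp statement and `OneConstantWallCeiling` the safe one).

References (as printed): E. Bombieri, Rend. Mat. Acc. Lincei (9) 11 (2000) Thm 2, §4 [`Bombieri2000Weil`]; H. Yoshida, Adv. Stud. Pure
Math. 21 (1992) Prop. 6 [`Yoshida1992HermitianForms`].
-/

set_option linter.dupNamespace false

noncomputable section

open Set Literature.NumberTheory.LFunctions
open Summit.RiemannHypothesis.RiemannHypothesis.Theorems.MotivicDoor.SemilocalThreshold
open Summit.RiemannHypothesis.RiemannHypothesis.Theorems.HandoffMarginLaw (wallOffset)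
open Summit.RiemannHypothesis.RiemannHypothesis.Theorems.HandoffDecomposition (nextPrime consecutivePrimes_nextPrime)
open Summit.RiemannHypothesis.RiemannHypothesis.Theorems.Handoff
open Summit.RiemannHypothesis.RiemannHypothesis.Theorems.MotivicDoor.SemilocalMarkov
open MeasureTheory

namespace Summit.RiemannHypothesis.RiemannHypothesis.Theorems.WeilColumn

/-! ## §1  Scale-generic ceiling and witness family (the reduction is the tree's, verbatim at a general scale) -/

/-- **RH-FREE.** The wall offsets are eventually below the scale `s`: `∀ primes q ≥ q₀, δ*(q) ≤ s q`. [this column, WEIL-THEORY-R1 §3(c)] -/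
def WallCeilingAtScale (s : ℕ → ℝ) (q₀ : ℕ) : Prop :=
  ∀ q : ℕ, q.Prime → q₀ ≤ q → wallOffset q ≤ s q

/-- **RH-FREE (analytic input).** A sub-window witness family at scale `s`: for consecutive primes `q < q′`, `q ≥ q₀`, a Weil test
function in the `q`-subwindow whose `δ`-translate pair has full-form energy below its weighted collar overlap at a shift `δ ≤ s q`
inside the handoff window — `Handoff.SubwindowWitnessFamily` with the scale made a parameter. [this column; handoff-prove-2 ATTEMPT-15 §3] -/
def SubwindowWitnessFamilyAtScale (s : ℕ → ℝ) (q₀ : ℕ) : Prop :=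
  ∀ q q' : ℕ, ConsecutivePrimes q q' → q₀ ≤ q →
    ∃ θ : ℝ → ℂ, ∃ δ : ℝ, IsWeilTest θ ∧ tsupport θ ⊆ Icc (-(Real.log q / 2)) (Real.log q / 2) ∧ 0 ≤ δ ∧
      δ ≤ s q ∧ Real.log q / 2 + δ ≤ Real.log q' / 2 ∧
      (weilQuadratic fun x ↦ θ (x - δ) - θ (x + δ)).re <
        2 * Real.log q / Real.sqrt q * (weilConv θ (weilReflect θ) (Real.log q - 2 * δ)).re

/-- **Reduction (THEOREM, RH-free): a witness family at scale `s` gives the ceiling at scale `s`** — the small-translate criterion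
`wallOffset_lt_of_translatePair` at each prime with its successor. [this column; = `dodgerWallCeiling_of_subwindowWitnessFamily` at general scale] -/
theorem wallCeilingAtScale_of_witnessFamily {s : ℕ → ℝ} {q₀ : ℕ} (h : SubwindowWitnessFamilyAtScale s q₀) :
    WallCeilingAtScale s q₀ := by
  intro q hq hq₀
  obtain ⟨θ, δ, hθ, hθs, hδ, hδs, hwin, hneg⟩ := h q (nextPrime q) (consecutivePrimes_nextPrime hq) hq₀
  exact (wallOffset_lt_of_translatePair (consecutivePrimes_nextPrime hq) hθ hθs hδ hwin hneg).le.trans hδs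

/-- Ceilings are monotone in the scale from the threshold on. [elementary] -/
theorem WallCeilingAtScale.mono {s s' : ℕ → ℝ} {q₀ q₁ : ℕ} (h : WallCeilingAtScale s q₀)
    (hss' : ∀ q : ℕ, q.Prime → q₁ ≤ q → s q ≤ s' q) : WallCeilingAtScale s' (max q₀ q₁) := by
  intro q hq hq'
  exact (h q hq (le_of_max_le_left hq')).trans (hss' q hq (le_of_max_le_right hq'))

/-- The tree's exponent-3/2 target IS the ceiling at the dodger scale `C (log q)^{3/2} q^{−3/2}`. [bookkeeping] -/
theorem dodgerWallCeiling_iff (C : ℝ) (q₀ : ℕ) :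
    DodgerWallCeiling C q₀ ↔
      WallCeilingAtScale (fun q ↦ C * Real.log q ^ (3 / 2 : ℝ) * (q : ℝ) ^ (-(3 / 2 : ℝ))) q₀ := Iff.rfl

/-! ## §1b  The witness class of the CERTIFIED cells: Markov witnesses (bounded, odd, a.e.-continuous — jumps allowed)
The K-cells' negative vectors are piecewise polynomials with jumps, hence NOT `IsWeilTest`; the tree's jump-tolerant bridge is cc-s2-4's
`weilSemilocalThreshold_le_of_markovWitness_window` (window decomposition with `N` atoms + mollifier criterion). The same scale-generic
reduction holds for that class, so a typed ceiling can be discharged prime by prime by exactly the kind of object the data certify. -/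

/-- **RH-FREE (analytic input, jump-tolerant).** A Markov witness family at scale `s`: for every prime `q ≥ q₀` an ODD bounded
a.e.-continuous `G` supported in `[−b, b]` with `b ≤ (log q)/2 + s q`, `b < (log (N+1))/2`, whose atom energies on `S_q = {p < q}` plus
archimedean energy lie below `C_{S_q,N}‖G‖² + 2|Ĝ(1)|²` (the mollifier criterion of `SemilocalWindowMarkov`). [this column; bridge = cc-s2-4's] -/
def MarkovWitnessFamilyAtScale (s : ℕ → ℝ) (q₀ : ℕ) : Prop :=
  ∀ q : ℕ, q.Prime → q₀ ≤ q → ∃ (G : ℝ → ℂ) (b M : ℝ) (N : ℕ), IsMarkovWitness G b M ∧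
    IntegrableOn (fun t ↦ weilArchDensity t * weilIncrement G t) (Ioi 0) ∧
    semilocalAtomEnergy (Nat.primesBelow q) N G + (∫ t in Ioi (0 : ℝ), weilArchDensity t * weilIncrement G t) <
      semilocalWindowConstant (Nat.primesBelow q) N * (∫ x, ‖G x‖ ^ 2) + 2 * ‖weilMellin G 1‖ ^ 2 ∧
    b < Real.log ((N : ℝ) + 1) / 2 ∧ b ≤ Real.log q / 2 + s q

/-- **Reduction (THEOREM, RH-free): a Markov witness family at scale `s` gives the ceiling at scale `s`** — via the jump-tolerant
bridge `weilSemilocalThreshold_le_of_markovWitness_window` (`a*(S_q) ≤ b`) and `δ*(q) = a*(S_q) − (log q)/2`. [this column] -/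
theorem wallCeilingAtScale_of_markovWitnessFamily {s : ℕ → ℝ} {q₀ : ℕ} (h : MarkovWitnessFamilyAtScale s q₀) :
    WallCeilingAtScale s q₀ := by
  intro q hq hq₀
  obtain ⟨G, b, M, N, hW, hfin, hlt, hb, hbs⟩ := h q hq hq₀
  have hle := weilSemilocalThreshold_le_of_markovWitness_window (Nat.primesBelow q) N hW hfin hlt hb
  show wallOffset q ≤ s q
  unfold wallOffset
  linarith

/-! ## §2  The two fork scales, typed (parameters, not fitted constants) -/

/-- (C) branch scale: the ONE-CONSTANT law `c/(w_q q²) = c/(2 q^{3/2} log q)` (exponent 3/2, log power −1). [this column, R1 §2 (C)] -/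
def oneConstantScale (c : ℝ) (q : ℕ) : ℝ := c / (2 * (q : ℝ) ^ (3 / 2 : ℝ) * Real.log q)

/-- (T) branch scale: the TOWER envelope `(A log q + B)²/q²` (exponent 2, log power +2; idea-1's `(a log q + 2.43)²(1+2.07/q)/(32π² q²)`
is below it with `A = a(1+η)/(4π√2)`, `B = 2.43(1+η)/(4π√2)` from the `q` where `1 + 2.07/q ≤ (1+η)²`). [this column, R1 §2 (T)/(T′)] -/
def towerScale (A B : ℝ) (q : ℕ) : ℝ := (A * Real.log q + B) ^ 2 / (q : ℝ) ^ 2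

/-- **RH-FREE TARGET (C-branch): the one-constant wall ceiling** `∀ primes q ≥ q₀, δ*(q) ≤ c/(2 q^{3/2} log q)`. [this column, R1 §3(b) upper half] -/
def OneConstantWallCeiling (c : ℝ) (q₀ : ℕ) : Prop := WallCeilingAtScale (oneConstantScale c) q₀

/-- **RH-FREE TARGET (T-branch): the tower wall ceiling** `∀ primes q ≥ q₀, δ*(q) ≤ (A log q + B)²/q²` — exponent 2; the column's
bookable prover target if the certified walls pick the decaying branch (T′)/(L) of the fork. [this column, R1 §3(c)] -/
def TowerWallCeiling (A B : ℝ) (q₀ : ℕ) : Prop := WallCeilingAtScale (towerScale A B) q₀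

/-- Either target follows from a witness family at its own scale (instances of §1's reduction). [this column] -/
theorem towerWallCeiling_of_witnessFamily {A B : ℝ} {q₀ : ℕ} (h : SubwindowWitnessFamilyAtScale (towerScale A B) q₀) :
    TowerWallCeiling A B q₀ := wallCeilingAtScale_of_witnessFamily h

/-- The one-constant target from a witness family at its scale (instance of §1's reduction). [this column] -/
theorem oneConstantWallCeiling_of_witnessFamily {c : ℝ} {q₀ : ℕ} (h : SubwindowWitnessFamilyAtScale (oneConstantScale c) q₀) :
    OneConstantWallCeiling c q₀ := wallCeilingAtScale_of_witnessFamily h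

/-! ## §3  Order of strength where the comparison is elementary: ONE-CONSTANT(c) ⟹ DODGER(C) for `q ≥ 3`, `0 ≤ c ≤ 2C` -/

/-- Pointwise: the one-constant scale is below the dodger scale for `q ≥ 3` when `0 ≤ c ≤ 2C`
(`c/(2 q^{3/2} log q) ≤ (c/2) q^{−3/2} ≤ C (log q)^{3/2} q^{−3/2}`). [elementary] -/
theorem oneConstantScale_le_dodgerScale {c C : ℝ} (hc : 0 ≤ c) (hcC : c ≤ 2 * C) {q : ℕ} (hq : 3 ≤ q) :
    oneConstantScale c q ≤ C * Real.log q ^ (3 / 2 : ℝ) * (q : ℝ) ^ (-(3 / 2 : ℝ)) := by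
  have hq0 : (0 : ℝ) < q := by exact_mod_cast (show 0 < q by omega)
  have hlog : 1 ≤ Real.log q := by
    rw [Real.le_log_iff_exp_le (by exact_mod_cast (show 0 < q by omega))]
    exact Real.exp_one_lt_three.le.trans (by exact_mod_cast hq)
  have hqpow : 0 < (q : ℝ) ^ (3 / 2 : ℝ) := Real.rpow_pos_of_pos hq0 _
  have hlogpow : 1 ≤ Real.log q ^ (3 / 2 : ℝ) := Real.one_le_rpow hlog (by norm_num)
  have hC : 0 ≤ C := by linarith
  unfold oneConstantScale
  rw [Real.rpow_neg hq0.le, div_le_iff₀ (by positivity)]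
  calc c = c / 2 * 1 * 1 * 2 := by ring
    _ ≤ C * Real.log q ^ (3 / 2 : ℝ) * Real.log q * 2 := by gcongr; linarith
    _ = C * Real.log q ^ (3 / 2 : ℝ) * ((q : ℝ) ^ (3 / 2 : ℝ))⁻¹ * (2 * (q : ℝ) ^ (3 / 2 : ℝ) * Real.log q) := by
          field_simp

/-- **ONE-CONSTANT(c) from `q₀` ⟹ DODGER(C) from `max q₀ 3`** whenever `0 ≤ c ≤ 2C`: the (C) branch's upper half lives INSIDE the
tree's typed exponent-3/2 target (it sharpens only the log power, 3/2 → −1). [this column] -/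
theorem dodgerWallCeiling_of_oneConstant {c C : ℝ} {q₀ : ℕ} (hc : 0 ≤ c) (hcC : c ≤ 2 * C)
    (h : OneConstantWallCeiling c q₀) : DodgerWallCeiling C (max q₀ 3) :=
  (dodgerWallCeiling_iff C _).2 (h.mono fun _ _ hq ↦ oneConstantScale_le_dodgerScale hc hcC hq)

/-! ## §3b  TOWER(A, B) ⟹ DODGER(C) for every `C > 0`, from an explicit threshold (`2(|A|+|B|)⁴ ≤ C²√q₁`, `q₁ ≥ 3`) -/

/-- `x^{3/2} = (√x)³` for `x ≥ 0`. [elementary] -/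
theorem rpow_three_halves_eq_sqrt_pow (x : ℝ) (hx : 0 ≤ x) : x ^ (3 / 2 : ℝ) = Real.sqrt x ^ 3 := by
  rw [Real.sqrt_eq_rpow, ← Real.rpow_natCast, ← Real.rpow_mul hx]
  norm_num

/-- `log x ≤ 2√x` for `x ≥ 0`. [elementary; `Real.log_le_rpow_div` at `ε = 1/2`] -/
theorem log_le_two_mul_sqrt (x : ℝ) (hx : 0 ≤ x) : Real.log x ≤ 2 * Real.sqrt x := by
  have := Real.log_le_rpow_div hx (by norm_num : (0:ℝ) < 1/2)
  rw [Real.sqrt_eq_rpow]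
  linarith [this]

/-- Pointwise: the tower scale is below the dodger scale at every `q ≥ 3` with `2(|A|+|B|)⁴ ≤ C²·√q`
(`(A log q + B)² ≤ (|A|+|B|)² log² q` and `(|A|+|B|)² √(log q) ≤ C √q` because `log q ≤ 2√q`). [elementary] -/
theorem towerScale_le_dodgerScale {A B C : ℝ} {q : ℕ} (hq : 3 ≤ q) (hC : 0 ≤ C)
    (hsep : 2 * (|A| + |B|) ^ 4 ≤ C ^ 2 * Real.sqrt q) :
    towerScale A B q ≤ C * Real.log q ^ (3 / 2 : ℝ) * (q : ℝ) ^ (-(3 / 2 : ℝ)) := by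
  have hq0 : (0 : ℝ) < q := by exact_mod_cast (show 0 < q by omega)
  have hL1 : 1 ≤ Real.log q := by
    rw [Real.le_log_iff_exp_le (by exact_mod_cast (show 0 < q by omega))]
    exact Real.exp_one_lt_three.le.trans (by exact_mod_cast hq)
  have hL0 : 0 ≤ Real.log q := by linarith
  unfold towerScale
  set L := Real.log q with hLdef
  set s := Real.sqrt (q : ℝ) with hsdef
  set m := Real.sqrt L with hmdef
  have hs0 : 0 < s := Real.sqrt_pos.2 hq0
  have hm1 : 1 ≤ m := by rw [hmdef, ← Real.sqrt_one]; exact Real.sqrt_le_sqrt hL1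
  have hm0 : 0 < m := by linarith
  have hQ : (q : ℝ) = s ^ 2 := by rw [hsdef, Real.sq_sqrt hq0.le]
  have hLm : L = m ^ 2 := by rw [hmdef, Real.sq_sqrt hL0]
  have hK : 0 ≤ |A| + |B| := by positivity
  have h1 : (A * L + B) ^ 2 ≤ ((|A| + |B|) * L) ^ 2 := by
    have habs : |A * L + B| ≤ (|A| + |B|) * L := by
      calc |A * L + B| ≤ |A * L| + |B| := abs_add_le _ _
        _ = |A| * L + |B| := by rw [abs_mul, abs_of_nonneg hL0]
        _ ≤ |A| * L + |B| * L := by nlinarith [abs_nonneg B]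
        _ = (|A| + |B|) * L := by ring
    calc (A * L + B) ^ 2 = |A * L + B| ^ 2 := (sq_abs _).symm
      _ ≤ ((|A| + |B|) * L) ^ 2 := by gcongr
  have h2 : (|A| + |B|) ^ 2 * m ≤ C * s := by
    have hsq : ((|A| + |B|) ^ 2 * m) ^ 2 ≤ (C * s) ^ 2 := by
      have hlog : L ≤ 2 * s := log_le_two_mul_sqrt _ hq0.le
      calc ((|A| + |B|) ^ 2 * m) ^ 2 = (|A| + |B|) ^ 4 * L := by rw [hLm]; ring
        _ ≤ (|A| + |B|) ^ 4 * (2 * s) := by gcongr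
        _ = (2 * (|A| + |B|) ^ 4) * s := by ring
        _ ≤ (C ^ 2 * s) * s := by gcongr
        _ = (C * s) ^ 2 := by ring
    exact (pow_le_pow_iff_left₀ (by positivity) (by positivity) two_ne_zero).1 hsq
  rw [rpow_three_halves_eq_sqrt_pow _ hL0, Real.rpow_neg hq0.le, rpow_three_halves_eq_sqrt_pow _ hq0.le, ← hmdef, ← hsdef, hQ]
  rw [div_le_iff₀ (by positivity)]
  calc (A * L + B) ^ 2 ≤ ((|A| + |B|) * L) ^ 2 := h1
    _ = ((|A| + |B|) ^ 2 * m) * m ^ 3 := by rw [hLm]; ring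
    _ ≤ (C * s) * m ^ 3 := by gcongr
    _ = C * m ^ 3 * (s ^ 3)⁻¹ * (s ^ 2) ^ 2 := by field_simp

/-- **TOWER(A, B) from `q₀` ⟹ DODGER(C) from `max q₀ q₁`** for EVERY `C > 0`, once `q₁ ≥ 3` and `2(|A|+|B|)⁴ ≤ C²√q₁`: the (T)-branch
target is STRICTLY STRONGER than the tree's typed exponent-3/2 target — landing `TowerWallCeiling A B q₀` for any `A, B` would discharge
`DodgerWallCeiling C q₁'` for every positive `C` (handoff-prove-2's lane) from an explicit prime on. [this column] -/
theorem dodgerWallCeiling_of_tower {A B C : ℝ} {q₀ q₁ : ℕ} (hq₁ : 3 ≤ q₁) (hC : 0 ≤ C)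
    (hsep : 2 * (|A| + |B|) ^ 4 ≤ C ^ 2 * Real.sqrt q₁) (h : TowerWallCeiling A B q₀) :
    DodgerWallCeiling C (max q₀ q₁) :=
  (dodgerWallCeiling_iff C _).2 (h.mono fun q _ hq ↦ towerScale_le_dodgerScale (hq₁.trans hq) hC
    (hsep.trans (by gcongr)))

/-! ## §4  What is NOT typed here and why (RH-equivalence honesty)
* The LOWER halves («δ*(q) ≥ s q for all q») of either shape are `HandoffMargin s`-type laws and IMPLY RH
  (`HandoffMarginLaw.riemannHypothesis_of_handoffMargin`); they are RH-CONDITIONAL-PLUS and are not targets of this column.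
* TOWER(A,B) ⟹ ONE-CONSTANT(c) eventually (`(A log q + B)²/q² ≤ c/(2 q^{3/2} log q)` for `q ≥ q₁(A,B,c)`) is also true; only the two
  comparisons INTO the tree's `DodgerWallCeiling` are proved here (§3, §3b), since that is the typed target a landing would discharge.
* The fork's DECISION (statistic β_N over certified two-sided walls, PREREG §5) is a protocol, not a proposition. -/


/-! ## §5  RUNG-LEAF CONSTANTS (ladder RH, column WEIL, rung W-P; D-0061: closed `Prop` constants, parameters wrapped by `∃`) and the implications between them
All three are RH-FREE upper-side statements; none implies RH; RH implies none of them. -/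

/-- **W-P leaf (P3, SAFE branch of the data fork) — RH-FREE.** «The semilocal wall offsets obey a one-constant ceiling»:
`∃ c q₀, ∀ primes q ≥ q₀, δ*(q) ≤ c/(2 q^{3/2} log q)`. [this column, WEIL-THEORY-R2 §6; ROUTE-PROPOSAL-WeilSemilocal item 2] -/
def SemilocalOneConstantCeiling : Prop := ∃ c : ℝ, ∃ q₀ : ℕ, OneConstantWallCeiling c q₀

/-- **W-P leaf (P3, SHARP branch — CONDITIONAL on the data fork picking the tower shape) — RH-FREE.** «The semilocal wall offsets obey a
tower ceiling»: `∃ A B q₀, ∀ primes q ≥ q₀, δ*(q) ≤ (A log q + B)²/q²`. [this column, WEIL-THEORY-R2 §6; ROUTE-PROPOSAL-WeilSemilocal item 3] -/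
def SemilocalTowerCeiling : Prop := ∃ A B : ℝ, ∃ q₀ : ℕ, TowerWallCeiling A B q₀

/-- **W-P leaf (P1-type) — RH-FREE.** «Some exponent-3/2 ceiling holds»: `∃ C q₀, DodgerWallCeiling C q₀` (handoff-prove-2's typed target,
constant wrapped). [HANDOFF track ATTEMPT-15 §5; ROUTE-PROPOSAL-WeilSemilocal item 4] -/
def SemilocalDodgerCeiling : Prop := ∃ C : ℝ, ∃ q₀ : ℕ, DodgerWallCeiling C q₀

/-- The one-constant scale is monotone in its constant (denominator `2 q^{3/2} log q ≥ 0` for every natural `q`). [elementary] -/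
theorem oneConstantScale_mono {c c' : ℝ} (h : c ≤ c') (q : ℕ) : oneConstantScale c q ≤ oneConstantScale c' q := by
  unfold oneConstantScale
  have hd : 0 ≤ 2 * (q : ℝ) ^ (3 / 2 : ℝ) * Real.log q :=
    mul_nonneg (mul_nonneg (by norm_num) (Real.rpow_nonneg (Nat.cast_nonneg q) _)) (Real.log_natCast_nonneg q)
  exact div_le_div_of_nonneg_right h hd

/-- **SHARP ⟹ P1-type**: a tower ceiling gives an exponent-3/2 ceiling (with `C = 1`, from an explicit prime). [this column, §3b] -/
theorem semilocalDodgerCeiling_of_tower (h : SemilocalTowerCeiling) : SemilocalDodgerCeiling := by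
  obtain ⟨A, B, q₀, hT⟩ := h
  set K : ℝ := 2 * (|A| + |B|) ^ 4 with hK
  have hK0 : 0 ≤ K := by positivity
  set N : ℕ := ⌈K ^ 2⌉₊ with hN
  refine ⟨1, max q₀ (max 3 N), dodgerWallCeiling_of_tower (le_max_left _ _) zero_le_one ?_ hT⟩
  have hcast : (N : ℝ) ≤ ((max 3 N : ℕ) : ℝ) := Nat.cast_le.mpr (le_max_right 3 N)
  have h1 : K ^ 2 ≤ ((max 3 N : ℕ) : ℝ) := (Nat.le_ceil (K ^ 2)).trans hcast
  rw [one_pow, one_mul]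
  exact (Real.le_sqrt hK0 (Nat.cast_nonneg _)).2 h1

/-- **SAFE ⟹ P1-type**: a one-constant ceiling gives an exponent-3/2 ceiling (constant `max c 0`, from `max q₀ 3`). [this column, §3] -/
theorem semilocalDodgerCeiling_of_oneConstant (h : SemilocalOneConstantCeiling) : SemilocalDodgerCeiling := by
  obtain ⟨c, q₀, hc⟩ := h
  have hc' : OneConstantWallCeiling (max c 0) q₀ := fun q hq hq₀ ↦
    (hc q hq hq₀).trans (oneConstantScale_mono (le_max_left c 0) q)
  exact ⟨max c 0, max q₀ 3, dodgerWallCeiling_of_oneConstant (le_max_right c 0) (by linarith [le_max_right c 0]) hc'⟩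

/-- **P1-type ⟹ the CLASS LAW's upper clause eventually** (`a*(S_q) < (log q⁺)/2` for all large primes — the tail of C-I(a) in UC form;
cc-s2-1's `SemilocalClassLaw.semilocalClassLawFrom_of_wallCeiling` restates it as `∃ q₁, SemilocalClassLawFrom q₁`). [HANDOFF track; this column] -/
theorem upperClause_eventually_of_semilocalDodgerCeiling (h : SemilocalDodgerCeiling) :
    ∃ q₁ : ℕ, ∀ q : ℕ, q₁ ≤ q → q.Prime →
      weilSemilocalThreshold (Nat.primesBelow q) < Real.log (nextPrime q) / 2 := by
  obtain ⟨C, q₀, hC⟩ := h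
  exact upperClause_eventually_of_dodgerWallCeiling hC

end Summit.RiemannHypothesis.RiemannHypothesis.Theorems.WeilColumn
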